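import Summits.KontsevichZagierPeriods.KontsevichZagierPeriods.Theorems.SoloInformedAlgDenCalculus
import Summits.KontsevichZagierPeriods.KontsevichZagierPeriods.Theorems.SoloInformedToricProducts
import HarnessLib

/-!
# Cube-nondegeneracy over `K` is multiplicatively closed; zero-free polynomials are nondegenerate

Solo programme `solo-KontsevichZagierPeriods-informed`, session s107: the DEN-calculus of the
cube crux over a coefficient field `K` of real algebraic numbers (`SoloInformedAlgDenCalculus`),
step (x-a) of the general two-dimensional algorithm — the supply of LEAVES.

* `soloInformed_initFormK_mul` — initial forms are multiplicative over a domain,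
  `in_w(Q₁ Q₂) = in_w(Q₁) · in_w(Q₂)` (port of `soloInformed_initForm_mul`);
* `soloInformed_cubeNondegenerateK_mul/_C/_one/_prod/_pow/_monomial/_X` — cube-nondegeneracy
  (`SoloInformedCubeNondegenerateK`) is preserved under products, powers, non-zero constants and
  monomials;
* `soloInformed_aevalK_faceProj` and **ND-UNIT** `soloInformed_cubeNondegenerateK_of_forall_ne_zero`
  — a polynomial with no zero on the CLOSED cube `[0,1]ⁿ` is cube-nondegenerate: its initial form
  `in_w(Q)` evaluated at `y ∈ (0,1]ⁿ` is `Q(y′)` for the face projection `y′` (`y′ᵢ = yᵢ` if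
  `wᵢ = 0`, else `0`), a point of the closed cube;
* `soloInformed_cubeNondegenerateK_monomial_mul_of_forall_ne_zero` — hence `monomial × unit`
  (`x^e · U`, `U` zero-free on `[0,1]ⁿ`) is cube-nondegenerate, and
  `soloInformed_presentableDenK_monomial_mul_of_forall_ne_zero` — such denominators are
  presentable (RULE ND, `soloInformed_presentableDenK_of_nondegenerate`).  These are the leaves of
  the two-dimensional resolution algorithm: after the blow-ups every cell's denominator is a
  monomial (accumulated exceptional and boundary factors) times a unit.

References: A. G. Kouchnirenko, Invent. Math. 32 (1976) §1; J. Ayoub, EMS Newsl. 91 (2014) §2.2;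
J. Kollár, *Lectures on Resolution of Singularities* (2007), §1.8.
-/

noncomputable section

open scoped BigOperators
open MeasureTheory Set
open Literature.NumberTheory.Transcendental Literature.NumberTheory.Transcendental.KZ

namespace Summit.KontsevichZagierPeriods.KontsevichZagierPeriods.Theorems

variable {n : ℕ}

/-! ### Coefficients of initial forms -/

section CoeffRing

variable {k : Type*} [CommSemiring k]

open Classical in
/-- The coefficients of the initial form: `coeff e (in_w Q) = coeff e Q` if `e` is `w`-initial,
`0` otherwise. [this work] -/
theorem soloInformed_coeff_initFormK (w : Fin n → ℕ) (Q : MvPolynomial (Fin n) k)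
    (e : Fin n →₀ ℕ) :
    MvPolynomial.coeff e (soloInformedInitFormK w Q) =
      if SoloInformedIsInitK w Q e then MvPolynomial.coeff e Q else 0 := by
  unfold soloInformedInitFormK
  rw [MvPolynomial.coeff_sum]
  by_cases h : SoloInformedIsInitK w Q e
  · rw [if_pos h]
    by_cases he : e ∈ Q.support
    · rw [← Finset.add_sum_erase _ _ (Finset.mem_filter.2 ⟨he, h⟩), MvPolynomial.coeff_monomial,
        if_pos rfl, Finset.sum_eq_zero fun b hb => by
          rw [MvPolynomial.coeff_monomial, if_neg (Finset.ne_of_mem_erase hb)], add_zero]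
    · rw [MvPolynomial.notMem_support_iff.1 he]
      exact Finset.sum_eq_zero fun b hb => by
        rw [MvPolynomial.coeff_monomial, if_neg]
        rintro rfl
        exact he (Finset.mem_filter.1 hb).1
  · rw [if_neg h]
    exact Finset.sum_eq_zero fun b hb => by
      rw [MvPolynomial.coeff_monomial, if_neg]
      rintro rfl
      exact h (Finset.mem_filter.1 hb).2

/-- `in_w(0) = 0`. [this work] -/
theorem soloInformed_initFormK_of_zero (w : Fin n → ℕ) :
    soloInformedInitFormK w (0 : MvPolynomial (Fin n) k) = 0 := by
  classical
  unfold soloInformedInitFormK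
  rw [MvPolynomial.support_zero, Finset.filter_empty, Finset.sum_empty]

/-- For `Q` with `a₀` of least `w`-degree in `supp Q`: `a ∈ supp Q` is `w`-initial iff its
`w`-degree equals that of `a₀`. [this work] -/
theorem soloInformed_isInitK_iff_wdeg_eq (w : Fin n → ℕ) (Q : MvPolynomial (Fin n) k)
    {a₀ : Fin n →₀ ℕ} (ha₀ : a₀ ∈ Q.support)
    (hmin : ∀ b ∈ Q.support, soloInformedWDeg w a₀ ≤ soloInformedWDeg w b)
    {a : Fin n →₀ ℕ} (ha : a ∈ Q.support) :
    SoloInformedIsInitK w Q a ↔ soloInformedWDeg w a = soloInformedWDeg w a₀ := by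
  refine ⟨fun h => le_antisymm (h a₀ ha₀) (hmin a ha), fun h => ?_⟩
  intro b hb
  rw [h]
  exact hmin b hb

/-- `in_w(c · x^a) = c · x^a` for a monomial. [this work] -/
theorem soloInformed_initFormK_monomial (w : Fin n → ℕ) (a : Fin n →₀ ℕ) (c : k) :
    soloInformedInitFormK w (MvPolynomial.monomial a c) = MvPolynomial.monomial a c := by
  classical
  by_cases hc : c = 0
  · rw [hc, MvPolynomial.monomial_zero, soloInformed_initFormK_of_zero]
  unfold soloInformedInitFormK
  have hinit : SoloInformedIsInitK w (MvPolynomial.monomial a c) a := by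
    intro b hb
    rw [MvPolynomial.support_monomial, if_neg hc, Finset.mem_singleton] at hb
    rw [hb]
  rw [MvPolynomial.support_monomial, if_neg hc, Finset.filter_singleton, if_pos hinit,
    Finset.sum_singleton, MvPolynomial.coeff_monomial, if_pos rfl]

/-- `in_w(c) = c` for constants. [this work] -/
theorem soloInformed_initFormK_C (w : Fin n → ℕ) (c : k) :
    soloInformedInitFormK w (MvPolynomial.C c : MvPolynomial (Fin n) k) = MvPolynomial.C c := by
  rw [← MvPolynomial.monomial_zero', soloInformed_initFormK_monomial]

end CoeffRing

/-! ### Initial forms are multiplicative (coefficients in a domain) -/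

section Domain

variable {k : Type*} [CommRing k] [IsDomain k]

/-- **`in_w(Q₁ Q₂) = in_w(Q₁) · in_w(Q₂)`** over a domain.  [Kouchnirenko 1976, §1; this work] -/
theorem soloInformed_initFormK_mul (w : Fin n → ℕ) (Q₁ Q₂ : MvPolynomial (Fin n) k) :
    soloInformedInitFormK w (Q₁ * Q₂) =
      soloInformedInitFormK w Q₁ * soloInformedInitFormK w Q₂ := by
  classical
  by_cases h₁ : Q₁ = 0
  · rw [h₁, zero_mul, soloInformed_initFormK_of_zero, zero_mul]
  by_cases h₂ : Q₂ = 0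
  · rw [h₂, mul_zero, soloInformed_initFormK_of_zero, mul_zero]
  obtain ⟨a₁, ha₁, hmin₁⟩ := Finset.exists_min_image Q₁.support (soloInformedWDeg w)
    (MvPolynomial.support_nonempty.2 h₁)
  obtain ⟨a₂, ha₂, hmin₂⟩ := Finset.exists_min_image Q₂.support (soloInformedWDeg w)
    (MvPolynomial.support_nonempty.2 h₂)
  have hI₁ := fun a (ha : a ∈ Q₁.support) => soloInformed_isInitK_iff_wdeg_eq w Q₁ ha₁ hmin₁ ha
  have hI₂ := fun a (ha : a ∈ Q₂.support) => soloInformed_isInitK_iff_wdeg_eq w Q₂ ha₂ hmin₂ ha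
  -- the coefficients of the product of the initial forms
  have hc : ∀ e, MvPolynomial.coeff e (soloInformedInitFormK w Q₁ * soloInformedInitFormK w Q₂) =
      if soloInformedWDeg w e = soloInformedWDeg w a₁ + soloInformedWDeg w a₂ then
        MvPolynomial.coeff e (Q₁ * Q₂) else 0 := by
    intro e
    rw [MvPolynomial.coeff_mul, MvPolynomial.coeff_mul]
    split_ifs with he
    · refine Finset.sum_congr rfl fun p hp => ?_
      rw [Finset.HasAntidiagonal.mem_antidiagonal] at hp
      rw [soloInformed_coeff_initFormK, soloInformed_coeff_initFormK]
      by_cases hp₁ : p.1 ∈ Q₁.support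
      · by_cases hp₂ : p.2 ∈ Q₂.support
        · have hsum : soloInformedWDeg w p.1 + soloInformedWDeg w p.2 =
              soloInformedWDeg w a₁ + soloInformedWDeg w a₂ := by
            rw [← soloInformed_wdeg_add, hp, he]
          have hl₁ := hmin₁ _ hp₁
          have hl₂ := hmin₂ _ hp₂
          have h1 : soloInformedWDeg w p.1 = soloInformedWDeg w a₁ := by omega
          have h2 : soloInformedWDeg w p.2 = soloInformedWDeg w a₂ := by omega
          rw [if_pos ((hI₁ _ hp₁).2 h1), if_pos ((hI₂ _ hp₂).2 h2)]
        · rw [MvPolynomial.notMem_support_iff.1 hp₂]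
          simp
      · rw [MvPolynomial.notMem_support_iff.1 hp₁]
        simp
    · refine Finset.sum_eq_zero fun p hp => ?_
      rw [Finset.HasAntidiagonal.mem_antidiagonal] at hp
      rw [soloInformed_coeff_initFormK, soloInformed_coeff_initFormK]
      by_cases hp₁ : p.1 ∈ Q₁.support
      · by_cases hp₂ : p.2 ∈ Q₂.support
        · by_cases hi₁ : SoloInformedIsInitK w Q₁ p.1
          · have hi₂ : ¬ SoloInformedIsInitK w Q₂ p.2 := fun hi₂ => he (by
              rw [← hp, soloInformed_wdeg_add, (hI₁ _ hp₁).1 hi₁, (hI₂ _ hp₂).1 hi₂])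
            rw [if_neg hi₂, mul_zero]
          · rw [if_neg hi₁, zero_mul]
        · rw [MvPolynomial.notMem_support_iff.1 hp₂]
          simp
      · rw [MvPolynomial.notMem_support_iff.1 hp₁]
        simp
  -- the product of the initial forms is non-zero: pick a witness exponent `e₀`
  have hne₁ : soloInformedInitFormK w Q₁ ≠ 0 := fun h => by
    have h' := congrArg (MvPolynomial.coeff a₁) h
    rw [soloInformed_coeff_initFormK,
      if_pos (show SoloInformedIsInitK w Q₁ a₁ from fun b hb => hmin₁ b hb),
      MvPolynomial.coeff_zero] at h'
    exact (MvPolynomial.mem_support_iff.1 ha₁) h'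
  have hne₂ : soloInformedInitFormK w Q₂ ≠ 0 := fun h => by
    have h' := congrArg (MvPolynomial.coeff a₂) h
    rw [soloInformed_coeff_initFormK,
      if_pos (show SoloInformedIsInitK w Q₂ a₂ from fun b hb => hmin₂ b hb),
      MvPolynomial.coeff_zero] at h'
    exact (MvPolynomial.mem_support_iff.1 ha₂) h'
  obtain ⟨e₀, he₀⟩ := MvPolynomial.ne_zero_iff.1 (mul_ne_zero hne₁ hne₂)
  have he₀d : soloInformedWDeg w e₀ = soloInformedWDeg w a₁ + soloInformedWDeg w a₂ := by
    by_contra h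
    rw [hc, if_neg h] at he₀
    exact he₀ rfl
  have he₀Q : MvPolynomial.coeff e₀ (Q₁ * Q₂) ≠ 0 := by rwa [hc, if_pos he₀d] at he₀
  -- every exponent of the product has `w`-degree at least the sum of the least degrees
  have hlow : ∀ e, MvPolynomial.coeff e (Q₁ * Q₂) ≠ 0 →
      soloInformedWDeg w a₁ + soloInformedWDeg w a₂ ≤ soloInformedWDeg w e := by
    intro e he
    rw [MvPolynomial.coeff_mul] at he
    obtain ⟨p, hp, hpne⟩ := Finset.exists_ne_zero_of_sum_ne_zero he
    rw [Finset.HasAntidiagonal.mem_antidiagonal] at hp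
    have hp₁ : p.1 ∈ Q₁.support := MvPolynomial.mem_support_iff.2 (left_ne_zero_of_mul hpne)
    have hp₂ : p.2 ∈ Q₂.support := MvPolynomial.mem_support_iff.2 (right_ne_zero_of_mul hpne)
    rw [← hp, soloInformed_wdeg_add]
    exact add_le_add (hmin₁ _ hp₁) (hmin₂ _ hp₂)
  -- compare coefficients
  ext e
  rw [soloInformed_coeff_initFormK, hc]
  by_cases he : MvPolynomial.coeff e (Q₁ * Q₂) = 0
  · rw [he]
    simp
  by_cases hd : soloInformedWDeg w e = soloInformedWDeg w a₁ + soloInformedWDeg w a₂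
  · have hinit : SoloInformedIsInitK w (Q₁ * Q₂) e := by
      intro b hb
      rw [hd]
      exact hlow b (MvPolynomial.mem_support_iff.1 hb)
    rw [if_pos hd, if_pos hinit]
  · have hinit : ¬ SoloInformedIsInitK w (Q₁ * Q₂) e := fun hinit =>
      hd (le_antisymm ((hinit e₀ (MvPolynomial.mem_support_iff.2 he₀Q)).trans he₀d.le)
        (hlow e he))
    rw [if_neg hd, if_neg hinit]

end Domain

/-! ### Closure properties of cube-nondegeneracy over `K` -/

variable {K : Type*} [Field K] [Algebra K ℝ]

/-- **Products of cube-nondegenerate polynomials are cube-nondegenerate.** [this work] -/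
theorem soloInformed_cubeNondegenerateK_mul {Q₁ Q₂ : MvPolynomial (Fin n) K}
    (h₁ : SoloInformedCubeNondegenerateK Q₁) (h₂ : SoloInformedCubeNondegenerateK Q₂) :
    SoloInformedCubeNondegenerateK (Q₁ * Q₂) := by
  intro w y hy
  rw [soloInformed_initFormK_mul, map_mul]
  exact mul_ne_zero (h₁ w y hy) (h₂ w y hy)

/-- Non-zero monomials `c · x^a` are cube-nondegenerate. [this work] -/
theorem soloInformed_cubeNondegenerateK_monomial (a : Fin n →₀ ℕ) {c : K} (hc : c ≠ 0) :
    SoloInformedCubeNondegenerateK (MvPolynomial.monomial a c : MvPolynomial (Fin n) K) := by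
  intro w y hy
  rw [soloInformed_initFormK_monomial, MvPolynomial.aeval_monomial,
    Finsupp.prod_fintype _ _ fun i => pow_zero _]
  exact mul_ne_zero ((map_ne_zero (algebraMap K ℝ)).2 hc)
    (Finset.prod_ne_zero_iff.2 fun i _ => pow_ne_zero _ (hy i).1.ne')

/-- Non-zero constants are cube-nondegenerate. [this work] -/
theorem soloInformed_cubeNondegenerateK_C {c : K} (hc : c ≠ 0) :
    SoloInformedCubeNondegenerateK (MvPolynomial.C c : MvPolynomial (Fin n) K) := by
  rw [← MvPolynomial.monomial_zero']
  exact soloInformed_cubeNondegenerateK_monomial 0 hc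

/-- `1` is cube-nondegenerate. [this work] -/
theorem soloInformed_cubeNondegenerateK_one :
    SoloInformedCubeNondegenerateK (1 : MvPolynomial (Fin n) K) := by
  rw [← MvPolynomial.C_1]
  exact soloInformed_cubeNondegenerateK_C one_ne_zero

/-- The variables `xⱼ` are cube-nondegenerate. [this work] -/
theorem soloInformed_cubeNondegenerateK_X (j : Fin n) :
    SoloInformedCubeNondegenerateK (MvPolynomial.X j : MvPolynomial (Fin n) K) := by
  rw [← pow_one (MvPolynomial.X j), MvPolynomial.X_pow_eq_monomial]
  exact soloInformed_cubeNondegenerateK_monomial _ one_ne_zero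

/-- Finite products of cube-nondegenerate polynomials are cube-nondegenerate. [this work] -/
theorem soloInformed_cubeNondegenerateK_prod {ι : Type*} (s : Finset ι)
    (Q : ι → MvPolynomial (Fin n) K) (h : ∀ i ∈ s, SoloInformedCubeNondegenerateK (Q i)) :
    SoloInformedCubeNondegenerateK (∏ i ∈ s, Q i) := by
  classical
  induction s using Finset.induction_on with
  | empty => simpa using (soloInformed_cubeNondegenerateK_one (n := n) (K := K))
  | insert a s ha ih =>
    rw [Finset.prod_insert ha]
    exact soloInformed_cubeNondegenerateK_mul (h a (Finset.mem_insert_self a s))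
      (ih fun i hi => h i (Finset.mem_insert_of_mem hi))

/-- Powers of cube-nondegenerate polynomials are cube-nondegenerate. [this work] -/
theorem soloInformed_cubeNondegenerateK_pow {Q : MvPolynomial (Fin n) K}
    (h : SoloInformedCubeNondegenerateK Q) (m : ℕ) : SoloInformedCubeNondegenerateK (Q ^ m) := by
  induction m with
  | zero => simpa using (soloInformed_cubeNondegenerateK_one (n := n) (K := K))
  | succ m ih =>
    rw [pow_succ]
    exact soloInformed_cubeNondegenerateK_mul ih h

/-! ### ND-UNIT: zero-free polynomials on the closed cube are cube-nondegenerate -/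

/-- The **face projection** of `y` for the weight `w`: keep the coordinates of weight `0`, set the
others to `0`. [this work] -/
def soloInformedFaceProj (w : Fin n → ℕ) (y : Fin n → ℝ) : Fin n → ℝ :=
  fun i => if w i = 0 then y i else 0

/-- The face projection of a point of `(0,1]ⁿ` lies in the closed cube. [this work] -/
theorem soloInformed_faceProj_mem_cube (w : Fin n → ℕ) {y : Fin n → ℝ}
    (hy : ∀ i, 0 < y i ∧ y i ≤ 1) : soloInformedFaceProj w y ∈ soloInformedCube n := by
  rw [soloInformed_mem_cube_iff]
  intro i
  unfold soloInformedFaceProj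
  split_ifs
  · exact ⟨(hy i).1.le, (hy i).2⟩
  · exact ⟨le_rfl, zero_le_one⟩

open Classical in
/-- **Evaluation at the face projection**: `Q(y′) = ∑_{a ∈ supp Q, wdeg a = 0} c_a y^a`.
[this work] -/
theorem soloInformed_aevalK_faceProj (w : Fin n → ℕ) (Q : MvPolynomial (Fin n) K)
    (y : Fin n → ℝ) :
    (MvPolynomial.aeval (soloInformedFaceProj w y) Q : ℝ) =
      ∑ a ∈ Q.support.filter (fun a => soloInformedWDeg w a = 0),
        algebraMap K ℝ (MvPolynomial.coeff a Q) * ∏ i, y i ^ a i := by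
  rw [soloInformed_aevalK_eq_sum_support, Finset.sum_filter]
  refine Finset.sum_congr rfl fun a _ => ?_
  by_cases ha : soloInformedWDeg w a = 0
  · rw [if_pos ha]
    congr 1
    refine Finset.prod_congr rfl fun i _ => ?_
    unfold soloInformedFaceProj
    rcases (soloInformed_wdeg_eq_zero_iff w a).1 ha i with hi | hi
    · rw [if_pos hi]
    · rw [hi, pow_zero, pow_zero]
  · rw [if_neg ha]
    obtain ⟨i, hi⟩ := not_forall.1 (mt (soloInformed_wdeg_eq_zero_iff w a).2 ha)
    rw [not_or] at hi
    refine mul_eq_zero_of_right _ (Finset.prod_eq_zero (Finset.mem_univ i) ?_)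
    unfold soloInformedFaceProj
    rw [if_neg hi.1, zero_pow hi.2]

open Classical in
/-- If `Q(y′) ≠ 0` for the face projection `y′` of `y`, then `in_w(Q)(y) = Q(y′)`: the least
`w`-degree over `supp Q` is `0` and the initial exponents are exactly those of `w`-degree `0`.
[this work] -/
theorem soloInformed_aeval_initFormK_eq_faceProj (w : Fin n → ℕ) (Q : MvPolynomial (Fin n) K)
    (y : Fin n → ℝ) (h : (MvPolynomial.aeval (soloInformedFaceProj w y) Q : ℝ) ≠ 0) :
    (MvPolynomial.aeval y (soloInformedInitFormK w Q) : ℝ) =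
      MvPolynomial.aeval (soloInformedFaceProj w y) Q := by
  -- some exponent of `w`-degree `0` lies in the support
  have hex : ∃ a₀ ∈ Q.support, soloInformedWDeg w a₀ = 0 := by
    by_contra hne
    apply h
    rw [soloInformed_aevalK_faceProj]
    exact Finset.sum_eq_zero fun a ha =>
      absurd ⟨a, (Finset.mem_filter.1 ha).1, (Finset.mem_filter.1 ha).2⟩ hne
  obtain ⟨a₀, ha₀, ha₀d⟩ := hex
  have hiff : ∀ a, SoloInformedIsInitK w Q a ↔ soloInformedWDeg w a = 0 := fun a =>
    ⟨fun hi => Nat.le_zero.1 (ha₀d ▸ hi a₀ ha₀), fun ha b _ => ha ▸ Nat.zero_le _⟩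
  rw [soloInformed_aeval_initFormK, soloInformed_aevalK_faceProj]
  exact Finset.sum_congr (Finset.filter_congr fun a _ => hiff a) fun _ _ => rfl

/-- **ND-UNIT.**  A polynomial with no zero on the closed cube `[0,1]ⁿ` is cube-nondegenerate.
[this work] -/
theorem soloInformed_cubeNondegenerateK_of_forall_ne_zero {Q : MvPolynomial (Fin n) K}
    (hQ : ∀ y ∈ soloInformedCube n, (MvPolynomial.aeval y Q : ℝ) ≠ 0) :
    SoloInformedCubeNondegenerateK Q := by
  intro w y hy
  have h := hQ _ (soloInformed_faceProj_mem_cube w hy)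
  rwa [soloInformed_aeval_initFormK_eq_faceProj w Q y h]

/-- **Monomial × unit is cube-nondegenerate**: `c · x^a · U` with `c ≠ 0` and `U` zero-free on the
closed cube. [this work] -/
theorem soloInformed_cubeNondegenerateK_monomial_mul_of_forall_ne_zero (a : Fin n →₀ ℕ) {c : K}
    (hc : c ≠ 0) {U : MvPolynomial (Fin n) K}
    (hU : ∀ y ∈ soloInformedCube n, (MvPolynomial.aeval y U : ℝ) ≠ 0) :
    SoloInformedCubeNondegenerateK (MvPolynomial.monomial a c * U) :=
  soloInformed_cubeNondegenerateK_mul (soloInformed_cubeNondegenerateK_monomial a hc)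
    (soloInformed_cubeNondegenerateK_of_forall_ne_zero hU)

/-! ### The leaves of the algorithm: RULE ND for zero-free and monomial × unit denominators -/

/-- **RULE UNIT-DEN.**  Over a field `K` of real algebraic numbers, a denominator with no zero on
the closed cube is presentable. [this work] -/
theorem soloInformed_presentableDenK_of_forall_ne_zero
    (hK : ∀ c : K, IsAlgebraic ℚ (algebraMap K ℝ c)) {Q : MvPolynomial (Fin n) K}
    (hQ : ∀ y ∈ soloInformedCube n, (MvPolynomial.aeval y Q : ℝ) ≠ 0) :
    SoloInformedPresentableDenK Q :=
  soloInformed_presentableDenK_of_nondegenerate hK (soloInformed_cubeNondegenerateK_of_forall_ne_zero hQ)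

/-- **RULE LEAF.**  Over a field `K` of real algebraic numbers, a denominator `c · x^a · U` with
`c ≠ 0` and `U` zero-free on the closed cube is presentable. [this work] -/
theorem soloInformed_presentableDenK_monomial_mul_of_forall_ne_zero
    (hK : ∀ c : K, IsAlgebraic ℚ (algebraMap K ℝ c)) (a : Fin n →₀ ℕ) {c : K} (hc : c ≠ 0)
    {U : MvPolynomial (Fin n) K} (hU : ∀ y ∈ soloInformedCube n, (MvPolynomial.aeval y U : ℝ) ≠ 0) :
    SoloInformedPresentableDenK (MvPolynomial.monomial a c * U) :=
  soloInformed_presentableDenK_of_nondegenerate hK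
    (soloInformed_cubeNondegenerateK_monomial_mul_of_forall_ne_zero a hc hU)

/-- **RULE FACTORS.**  Over a field `K` of real algebraic numbers, a product of cube-nondegenerate
denominators is presentable. [this work] -/
theorem soloInformed_presentableDenK_prod
    (hK : ∀ c : K, IsAlgebraic ℚ (algebraMap K ℝ c)) {ι : Type*} (s : Finset ι)
    (Qs : ι → MvPolynomial (Fin n) K) (hND : ∀ i ∈ s, SoloInformedCubeNondegenerateK (Qs i)) :
    SoloInformedPresentableDenK (∏ i ∈ s, Qs i) :=
  soloInformed_presentableDenK_of_nondegenerate hK (soloInformed_cubeNondegenerateK_prod s Qs hND)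

end Summit.KontsevichZagierPeriods.KontsevichZagierPeriods.Theorems
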